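import Summits.HodgeConjecture.HodgeConjecture.Theorems.AnchorTransportAnchorExistenceQbarFibreAnchors
import Summits.HodgeConjecture.HodgeConjecture.Theorems.AnchorTransportAnchorExistenceQbarFibreAssembly
import Summits.HodgeConjecture.HodgeConjecture.Theorems.QbarEnvelopeEnvelopeStubNumberFieldModel

/-!
# Route AnchorTransport — crux `AnchorExistence` (stmt-HodgeConjecture-1077): the crux BOUNDED ABOVE by existing debts

End state of the line `qbar-fibre-anchors` (lead c5, 2026-08-17), kernel-checked and CONDITIONAL (one direction
only — nothing here claims `AnchorExistence` implies any hypothesis back): the route decl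
`AnchorTransport.AnchorExistence` follows from four named hypotheses each of which is an already-filed shared item,
a registered stub of the sibling crux stmt-1069, or a named Literature fact — no statement of the line's own remains:

* `HCOverNumberFields` — the crux stmt-HodgeConjecture-1070 of route `QbarEnvelope` (the Hodge conjecture for
  smooth projective complex varieties definable over a number field);
* T — type stability at `ℚ̄`-generic points, Zariski-locally on the base (VERBATIM the registered transcendence
  kernel `stub_typeStabilityAtQbarGenericZariskiLocal` of the crux stmt-HodgeConjecture-1069; KOU Conj. 1.5 (a) at
  generic points, in substance `PeriodDeficiency.QbarGenericIsHodgeGeneric`, stmt-HodgeConjecture-11595);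
* C — `FundamentalGroup.riemannExistence_qbarDescent_of_finiteIndex` (Riemann existence with `ℚ̄`-descent of
  finite-index subgroups, SGA1 XII 5.1 + XIII 4.6; named fact);
* D — `deligne_globalInvariantCycles` (Hodge II Thm 4.1.1; named fact = shared item stmt-HodgeConjecture-16363).

Composition: T, C, D and the LANDED number-field descent `Theorems.stub_numberFieldModel` give `ℚ̄`-fibre anchors
for every Hodge pair (`QbarFibreAnchors.qbarFibreAnchors_of_typeStability_of_riemannExistence_of_globalInvariantCycles`, the Voisin
funnel read with the FAMILY as output), and `HCOverNumberFields` turns a `ℚ̄`-fibre into an algebraic anchor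
(`QbarFibreAnchors.anchorExistence_of_hcOverNumberFields_of_qbarFibreAnchors`).  The second theorem is the same
through route `PeriodDeficiency`'s typing of the transcendence input (`ClassicalGeometricVHS` stmt-11597,
`QbarGenericIsHodgeGeneric` stmt-11595, the named fact `bku_finite_monodromyOrbit_of_isHodgeGenericIn`).

## References

* [Voisin2007HodgeLoci] C. Voisin, Hodge loci and absolute Hodge classes, Compositio Math. 143 (2007), Thm. 0.5 (2),
  Prop. 1.2, Prop. 1.7, §3.
* [CharlesSchnell2014Notes] F. Charles, C. Schnell, Notes on absolute Hodge classes, Thm. 11.3.19.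
* [KlinglerOtwinowskaUrbanik2023] B. Klingler, A. Otwinowska, D. Urbanik, On the fields of definition of Hodge
  loci, Conj. 1.5 (a), Thm. 1.12.
-/

noncomputable section

-- The mandated namespace `Summit.<P>.<Sub>.Theorems.…` repeats `HodgeConjecture` (single-conjunct summit).
set_option linter.dupNamespace false

namespace Summit.HodgeConjecture.HodgeConjecture.Theorems.QbarFibreAnchors

open CategoryTheory AlgebraicGeometry
open Literature.AlgebraicGeometry Literature.AlgebraicGeometry.Motives
  Literature.AlgebraicGeometry.HodgeTheory Literature.AlgebraicTopology.SingularHomology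
open Summit.HodgeConjecture.HodgeConjecture.Theses.AnchorTransport

/-- **`AnchorExistence` from existing debts only: `HCOverNumberFields` (stmt-1070) ∧ T ∧ C ∧ D.**  T = type
stability at `ℚ̄`-generic points Zariski-locally (stmt-1069's registered transcendence kernel, verbatim), C = Riemann
existence with `ℚ̄`-descent (named fact), D = the global invariant cycle theorem (named fact = stmt-16363); the
number-field descent N is the landed `Theorems.stub_numberFieldModel`.  CONDITIONAL result: the four hypotheses
are open items / unproved named facts of the tree. [cite: Voisin2007HodgeLoci, Thm. 0.5 (2), Prop. 1.2 and §3]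
[cite: CharlesSchnell2014Notes, Thm. 11.3.19] -/
theorem anchorExistence_of_hcOverNumberFields_of_typeStability_of_riemannExistence_of_globalInvariantCycles :
    Summit.HodgeConjecture.HodgeConjecture.Theses.QbarEnvelope.HCOverNumberFields →
    (∀ (σ : AlgebraicClosure ℚ →+* ℂ) ⦃𝒳₀ S₀ : SchemeOver (AlgebraicClosure ℚ)⦄ (f₀ : 𝒳₀ ⟶ S₀)
      (n p : ℕ), IsQuasiProjectiveOver 𝒳₀ → IsQuasiProjectiveOver S₀ → IrreducibleSpace S₀.left →
      AlgebraicGeometry.Smooth S₀.hom → IsSmoothProjectiveFamily ((baseChangeHom σ).map f₀) n →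
      ∀ (s : ComplexPoints ((baseChangeHom σ).obj S₀)),
        closure {(baseChangeHomFst σ S₀).base s.pt} = (Set.univ : Set S₀.left) →
        ∀ (α : complexBetti (fiberOver ((baseChangeHom σ).map f₀) s) (2 * p)),
          IsRationalClass α → IsOfHodgeType n (fiberOver ((baseChangeHom σ).map f₀) s) (2 * p) p p α →
          ∃ Z₀ : Set S₀.left, IsClosed Z₀ ∧ Z₀ ≠ Set.univ ∧
            ∀ (γ : Path s s), (∀ u, (baseChangeHomFst σ S₀).base (γ u).pt ∉ Z₀) →
              ∀ (β : complexBetti (fiberOver ((baseChangeHom σ).map f₀) s) (2 * p)),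
                IsContinuationAlong γ α β →
                  IsOfHodgeType n (fiberOver ((baseChangeHom σ).map f₀) s) (2 * p) p p β) →
    Literature.AlgebraicGeometry.FundamentalGroup.riemannExistence_qbarDescent_of_finiteIndex →
    deligne_globalInvariantCycles →
    AnchorExistence :=
  fun hC1 hT hRE hD ↦
    anchorExistence_of_hcOverNumberFields_of_qbarFibreAnchors hC1
      (qbarFibreAnchors_of_typeStability_of_riemannExistence_of_globalInvariantCycles hT hRE hD)

/-- **`AnchorExistence` from existing debts only, `PeriodDeficiency` typing of the transcendence input**:
`HCOverNumberFields` (stmt-1070) ∧ `ClassicalGeometricVHS` (stmt-11597) ∧ `QbarGenericIsHodgeGeneric` (stmt-11595) ∧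
the named fact `bku_finite_monodromyOrbit_of_isHodgeGenericIn` ∧ C ∧ D (as above), N landed.  CONDITIONAL result.
[cite: KlinglerOtwinowskaUrbanik2023, Conj. 1.5 (a) and Thm. 1.12] [cite: Voisin2007HodgeLoci, Prop. 1.2 and §3] -/
theorem anchorExistence_of_hcOverNumberFields_of_qbarGenericIsHodgeGeneric :
    Summit.HodgeConjecture.HodgeConjecture.Theses.QbarEnvelope.HCOverNumberFields →
    Summit.HodgeConjecture.HodgeConjecture.Theses.PeriodDeficiency.ClassicalGeometricVHS →
    Summit.HodgeConjecture.HodgeConjecture.Theses.PeriodDeficiency.QbarGenericIsHodgeGeneric →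
    bku_finite_monodromyOrbit_of_isHodgeGenericIn →
    Literature.AlgebraicGeometry.FundamentalGroup.riemannExistence_qbarDescent_of_finiteIndex →
    deligne_globalInvariantCycles →
    AnchorExistence :=
  fun hC1 hC hG hB hRE hD ↦
    anchorExistence_of_hcOverNumberFields_of_qbarFibreAnchors hC1
      (qbarFibreAnchors_of_qbarGenericIsHodgeGeneric' hC hG hB hRE hD)

/-! ### Only the MIDDLE RANGE of the transcendence kernel is needed -/

/-- **`AnchorExistence` needs the transcendence kernel only in the MIDDLE RANGE `2 ≤ p ≤ n - 2`**:
`HCOverNumberFields` (stmt-1070) ∧ T restricted to `2 ≤ p`, `p + 2 ≤ n` ∧ C ∧ D give the crux — in the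
Lefschetz range `p ≤ 1 ∨ n ≤ p + 1` the class is algebraic on `X` itself (Lefschetz `(1,1)` and hard
Lefschetz, theorems of the tree) and the constant family anchors it; in the middle range
the Assembly's pointwise `qbarFibreAnchorAt_of_typeStabilityAt` gives a `ℚ̄`-fibre, algebraic anchor by stmt-1070.  CONDITIONAL on the
three named hypotheses. [cite: VoisinHodgeI2002, Thm. 6.25 and Thm. 11.30] [cite: Voisin2007HodgeLoci, Thm. 0.5 (2) and Prop. 1.2] -/
theorem anchorExistence_of_hcOverNumberFields_of_typeStabilityMid_of_riemannExistence_of_globalInvariantCycles :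
    Summit.HodgeConjecture.HodgeConjecture.Theses.QbarEnvelope.HCOverNumberFields →
    (∀ (n p : ℕ), 2 ≤ p → p + 2 ≤ n →
      ∀ (σ : AlgebraicClosure ℚ →+* ℂ) ⦃𝒳₀ S₀ : SchemeOver (AlgebraicClosure ℚ)⦄ (f₀ : 𝒳₀ ⟶ S₀),
      IsQuasiProjectiveOver 𝒳₀ → IsQuasiProjectiveOver S₀ → IrreducibleSpace S₀.left →
      AlgebraicGeometry.Smooth S₀.hom → IsSmoothProjectiveFamily ((baseChangeHom σ).map f₀) n →
      ∀ (s : ComplexPoints ((baseChangeHom σ).obj S₀)),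
        closure {(baseChangeHomFst σ S₀).base s.pt} = (Set.univ : Set S₀.left) →
        ∀ (α : complexBetti (fiberOver ((baseChangeHom σ).map f₀) s) (2 * p)),
          IsRationalClass α → IsOfHodgeType n (fiberOver ((baseChangeHom σ).map f₀) s) (2 * p) p p α →
          ∃ Z₀ : Set S₀.left, IsClosed Z₀ ∧ Z₀ ≠ Set.univ ∧
            ∀ (γ : Path s s), (∀ u, (baseChangeHomFst σ S₀).base (γ u).pt ∉ Z₀) →
              ∀ (β : complexBetti (fiberOver ((baseChangeHom σ).map f₀) s) (2 * p)),
                IsContinuationAlong γ α β →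
                  IsOfHodgeType n (fiberOver ((baseChangeHom σ).map f₀) s) (2 * p) p p β) →
    Literature.AlgebraicGeometry.FundamentalGroup.riemannExistence_qbarDescent_of_finiteIndex →
    deligne_globalInvariantCycles →
    AnchorExistence := by
  intro hC1 hTmid hRE hD n X hX p c hc hpp
  by_cases hLef : p ≤ 1 ∨ n ≤ p + 1
  · exact anchorTransport_anchor_of_mem_algebraicClasses hX p c hc hpp
      (mem_algebraicClasses_of_lefschetzRange lefschetzOneOne_rational_holds
        (nonempty_hardLefschetzNFold_holds n X) hX hLef c hc hpp)
  have hp2 : 2 ≤ p := by omega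
  have hpn : p + 2 ≤ n := by omega
  obtain ⟨𝒳, S, f, s₁, s₀, e, A, hf, hirr, hsm, hfib, hAc, hdef⟩ :=
    qbarFibreAnchorAt_of_typeStabilityAt (hTmid n p hp2 hpn) hRE hD stub_numberFieldModel hX c hc hpp
  exact ⟨𝒳, S, f, s₁, s₀, e, A, hf, hirr, hsm, hfib, hAc,
    (hC1 (hf.isSmoothProjective s₀) hdef).2 p _ (hfib s₀).1 (hfib s₀).2⟩

/-- **Item-typed form of `anchorExistence_of_hcOverNumberFields_of_typeStability_of_riemannExistence_of_globalInvariantCycles`**: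
the same with Deligne's theorem taken as the shared ITEM
`PeriodDeficiency.DeligneGlobalInvariantCycles` (stmt-HodgeConjecture-16363), whose body is the named fact's verbatim
(conversion by definitional unfolding), so that a planner's `--glue-by` can cite item decls. CONDITIONAL.
[cite: DeligneHodgeII1971, Thm. 4.1.1] [cite: Voisin2007HodgeLoci, Prop. 1.2 and §3] -/
theorem anchorExistence_of_hcOverNumberFields_of_typeStability_of_riemannExistence_of_item16363 :
    Summit.HodgeConjecture.HodgeConjecture.Theses.QbarEnvelope.HCOverNumberFields →
    (∀ (σ : AlgebraicClosure ℚ →+* ℂ) ⦃𝒳₀ S₀ : SchemeOver (AlgebraicClosure ℚ)⦄ (f₀ : 𝒳₀ ⟶ S₀)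
      (n p : ℕ), IsQuasiProjectiveOver 𝒳₀ → IsQuasiProjectiveOver S₀ → IrreducibleSpace S₀.left →
      AlgebraicGeometry.Smooth S₀.hom → IsSmoothProjectiveFamily ((baseChangeHom σ).map f₀) n →
      ∀ (s : ComplexPoints ((baseChangeHom σ).obj S₀)),
        closure {(baseChangeHomFst σ S₀).base s.pt} = (Set.univ : Set S₀.left) →
        ∀ (α : complexBetti (fiberOver ((baseChangeHom σ).map f₀) s) (2 * p)),
          IsRationalClass α → IsOfHodgeType n (fiberOver ((baseChangeHom σ).map f₀) s) (2 * p) p p α →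
          ∃ Z₀ : Set S₀.left, IsClosed Z₀ ∧ Z₀ ≠ Set.univ ∧
            ∀ (γ : Path s s), (∀ u, (baseChangeHomFst σ S₀).base (γ u).pt ∉ Z₀) →
              ∀ (β : complexBetti (fiberOver ((baseChangeHom σ).map f₀) s) (2 * p)),
                IsContinuationAlong γ α β →
                  IsOfHodgeType n (fiberOver ((baseChangeHom σ).map f₀) s) (2 * p) p p β) →
    Literature.AlgebraicGeometry.FundamentalGroup.riemannExistence_qbarDescent_of_finiteIndex →
    Summit.HodgeConjecture.HodgeConjecture.Theses.PeriodDeficiency.DeligneGlobalInvariantCycles →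
    AnchorExistence :=
  fun hC1 hT hRE hD ↦
    anchorExistence_of_hcOverNumberFields_of_typeStability_of_riemannExistence_of_globalInvariantCycles hC1 hT
      hRE (fun 𝒳 Xbar S f i n m ↦ hD 𝒳 Xbar S f i n m)

/-- **What route `AnchorTransport` now owes, in full**: the summit statement from `VariationalHodge`
(stmt-1076, the route's other crux) ∧ `HCOverNumberFields` (stmt-1070) ∧ T ∧ C ∧ D — through the route's deciding
theorem `AnchorTransport.closes` with the proved `IsoInvariance` and `HodgeModels`.  For comparison (planners):
route `QbarEnvelope` owes `Envelope` (stmt-1069, whose birth line is `T → C → D → N → Envelope` with its mechanism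
B proved) ∧ stmt-1070 ∧ `PullbackAlgebraic` (stmt-1071, a theorem in print) — i.e. the SAME transcendence kernel and
facts, with `PullbackAlgebraic` in place of the open `VariationalHodge`.  CONDITIONAL.
[cite: CharlesSchnell2014Notes, Conj. 11.3.1 and Thm. 11.3.19] -/
theorem hodgeConjecture_of_variationalHodge_of_hcOverNumberFields_of_typeStability_of_riemannExistence_of_globalInvariantCycles :
    VariationalHodge →
    Summit.HodgeConjecture.HodgeConjecture.Theses.QbarEnvelope.HCOverNumberFields →
    (∀ (σ : AlgebraicClosure ℚ →+* ℂ) ⦃𝒳₀ S₀ : SchemeOver (AlgebraicClosure ℚ)⦄ (f₀ : 𝒳₀ ⟶ S₀)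
      (n p : ℕ), IsQuasiProjectiveOver 𝒳₀ → IsQuasiProjectiveOver S₀ → IrreducibleSpace S₀.left →
      AlgebraicGeometry.Smooth S₀.hom → IsSmoothProjectiveFamily ((baseChangeHom σ).map f₀) n →
      ∀ (s : ComplexPoints ((baseChangeHom σ).obj S₀)),
        closure {(baseChangeHomFst σ S₀).base s.pt} = (Set.univ : Set S₀.left) →
        ∀ (α : complexBetti (fiberOver ((baseChangeHom σ).map f₀) s) (2 * p)),
          IsRationalClass α → IsOfHodgeType n (fiberOver ((baseChangeHom σ).map f₀) s) (2 * p) p p α →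
          ∃ Z₀ : Set S₀.left, IsClosed Z₀ ∧ Z₀ ≠ Set.univ ∧
            ∀ (γ : Path s s), (∀ u, (baseChangeHomFst σ S₀).base (γ u).pt ∉ Z₀) →
              ∀ (β : complexBetti (fiberOver ((baseChangeHom σ).map f₀) s) (2 * p)),
                IsContinuationAlong γ α β →
                  IsOfHodgeType n (fiberOver ((baseChangeHom σ).map f₀) s) (2 * p) p p β) →
    Literature.AlgebraicGeometry.FundamentalGroup.riemannExistence_qbarDescent_of_finiteIndex →
    deligne_globalInvariantCycles →
    _root_.HodgeConjecture :=
  fun hV hC1 hT hRE hD ↦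
    Summit.HodgeConjecture.HodgeConjecture.Theses.AnchorTransport.closes hV
      (anchorExistence_of_hcOverNumberFields_of_typeStability_of_riemannExistence_of_globalInvariantCycles hC1 hT
        hRE hD)
      IsoInvariance_holds HodgeModels_holds

/-- **The DARK CASE (the line's former stub 3, v3's `stub_definable_of_pairRigid`; its statement inlined verbatim
below) from T ∧ C ∧ D** — "pair-rigid ⟹ definable over a number field" (cf. `PeriodDeficiency.IsolatedHodgePointsQbar`,
stmt-11594; no formal link) is implied by the transcendence kernel package (one direction): T + C + D (+ the landed N) give a `ℚ̄`-fibre anchor for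
every pair, and on a pair-rigid pair its `ℚ̄`-fibre is `≅ X` (`definable_of_pairRigid_of_qbarFibreAnchors`); the
extrinsic-movability hypothesis is not used.  CONDITIONAL on T, C, D. [cite: Voisin2007HodgeLoci, §0 and Thm. 0.5 (2)]
[cite: KlinglerOtwinowskaUrbanik2023, Cor. 1.14] -/
theorem stub_definable_of_pairRigid_of_typeStability_of_riemannExistence_of_globalInvariantCycles :
    (∀ (σ : AlgebraicClosure ℚ →+* ℂ) ⦃𝒳₀ S₀ : SchemeOver (AlgebraicClosure ℚ)⦄ (f₀ : 𝒳₀ ⟶ S₀)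
      (n p : ℕ), IsQuasiProjectiveOver 𝒳₀ → IsQuasiProjectiveOver S₀ → IrreducibleSpace S₀.left →
      AlgebraicGeometry.Smooth S₀.hom → IsSmoothProjectiveFamily ((baseChangeHom σ).map f₀) n →
      ∀ (s : ComplexPoints ((baseChangeHom σ).obj S₀)),
        closure {(baseChangeHomFst σ S₀).base s.pt} = (Set.univ : Set S₀.left) →
        ∀ (α : complexBetti (fiberOver ((baseChangeHom σ).map f₀) s) (2 * p)),
          IsRationalClass α → IsOfHodgeType n (fiberOver ((baseChangeHom σ).map f₀) s) (2 * p) p p α →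
          ∃ Z₀ : Set S₀.left, IsClosed Z₀ ∧ Z₀ ≠ Set.univ ∧
            ∀ (γ : Path s s), (∀ u, (baseChangeHomFst σ S₀).base (γ u).pt ∉ Z₀) →
              ∀ (β : complexBetti (fiberOver ((baseChangeHom σ).map f₀) s) (2 * p)),
                IsContinuationAlong γ α β →
                  IsOfHodgeType n (fiberOver ((baseChangeHom σ).map f₀) s) (2 * p) p p β) →
    Literature.AlgebraicGeometry.FundamentalGroup.riemannExistence_qbarDescent_of_finiteIndex →
    deligne_globalInvariantCycles →
    ∀ ⦃n : ℕ⦄ ⦃X : SchemeOver ℂ⦄, IsSmoothProjective n X →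
      ¬ (∀ ⦃𝒳 S : SchemeOver ℂ⦄ (f : 𝒳 ⟶ S) (s₁ s₀ : ComplexPoints S),
        IsSmoothProjectiveFamily f n → IrreducibleSpace S.left → AlgebraicGeometry.Smooth S.hom →
        Nonempty (X ≅ fiberOver f s₁) → Nonempty (X ≅ fiberOver f s₀)) →
      ∀ (p : ℕ) (c : complexBetti X (2 * p)), IsRationalClass c → IsOfHodgeType n X (2 * p) p p c →
      (∀ ⦃𝒳 S : SchemeOver ℂ⦄ (f : 𝒳 ⟶ S) (s₁ s₀ : ComplexPoints S) (e : X ≅ fiberOver f s₁)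
          (A : complexBetti 𝒳 (2 * p)),
        IsSmoothProjectiveFamily f n → IrreducibleSpace S.left → AlgebraicGeometry.Smooth S.hom →
        (∀ s : ComplexPoints S, IsRationalClass (complexBetti.map (fiberι f s) (2 * p) A) ∧
          IsOfHodgeType n (fiberOver f s) (2 * p) p p (complexBetti.map (fiberι f s) (2 * p) A)) →
        complexBetti.map e.hom (2 * p) (complexBetti.map (fiberι f s₁) (2 * p) A) = c →
        Nonempty (X ≅ fiberOver f s₀)) →
      ∃ (K : Type) (_ : Field K) (_ : NumberField K) (σ : K →+* ℂ) (X₀ : SchemeOver K),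
        Nonempty (X ≅ (baseChangeHom σ).obj X₀) :=
  fun hT hRE hD _ _ hX _ p c hc hpp hpr ↦
    definable_of_pairRigid_of_qbarFibreAnchors
      (qbarFibreAnchors_of_typeStability_of_riemannExistence_of_globalInvariantCycles hT hRE hD) hX p c hc hpp hpr

end Summit.HodgeConjecture.HodgeConjecture.Theorems.QbarFibreAnchors

end
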